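import Summits.Langlands.Langlands.Theses.ExteriorSquareAscent

/-!
# Birth skeleton (BC3) for crux stmt-Langlands-18054
`Summit.Langlands.Langlands.Theses.ExteriorSquareAscent.ReducibleInducesSquare` — line `birth`

Route `route-Langlands-ExteriorSquareAscent` (crux #3, rank 3). The crux: let `K` be ANY number field, `π`
cuspidal on `GL₄(𝔸_K)` with a Hecke field (Clozel rationality of the C-normalised Satake polynomials), NOT
essentially self-dual and NOT quadratically self-twisted at Satake level; let `ρ : Γ_K → GL₄(ℚ̄_ℓ)` be
semisimple, Satake–Frobenius compatible with `(π, ι)` at almost all places (`arithFrobPolyOfSatake ι q_v 4`) and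
REDUCIBLE. Then there are a quadratic `L/K` and a cuspidal `P` on `GL₃(𝔸_L)` whose automorphic-induction Satake
data are the exterior-square Satake data `{t_i t_j}_{i<j}` of `π` almost everywhere (the hypothesis of the
route's lever `InducedSquareAscent`). Printed source: Shavali, arXiv:2603.19768, §4, Propositions 4.1–4.2,
where p. 10 says "Throughout this section, we assume that K is a totally real number field" and `ρ = ρ_(π,𝔭)`;
the crux transplants both propositions to every number field and every a.e.-compatible semisimple `ρ`.

The line `birth` is the paper's own cut, which is also the route's declared two-layer plan
(`ReducibleInducesSquare ⇐ NoStableLine → StablePlaneInducesSquare → glue`):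

* `stub_noStableLine` — **the (3,1)-case is impossible over any number field** (Shavali Prop. 4.1
  transplanted; size L). For `π` cuspidal on `GL₄(𝔸_K)` with a Hecke field and `ρ` semisimple, a.e.-compatible
  with `(π, ι)`, NO `Γ_K`-stable LINE exists: every subrepresentation of `ρ` has dimension `≠ 1`. Proof line
  (any `K`): a stable line carries a character `τ`, a weak abelian direct summand of the `E`-rational `ρ`, so
  Böckle–Hui Thm 1.1 (IN TREE, proved: `exists_heckeCharacter_of_weaklyDivides_holds`) makes `τ ↔ η` and
  `det σ ↔ χ` (via `∧³ρ`) algebraic Hecke characters; Shavali's eight-term virtual identity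
  `∧²ρ·τ⁻² + τ⁻³det σ + 1 = ρ^∨·det σ·τ⁻² + ρ·τ⁻¹` gives
  `L^S(s,∧²π⊗η⁻²)·L^S(s,η⁻³χ)·ζ_K^S(s) = L^S(s,π^∨⊗χη⁻²)·L^S(s,π⊗η⁻¹)`: right side entire (GL₄ × GL₁,
  π cuspidal), left side has the pole of `ζ_K` at `s = 1` once the weights of `η, χ` are pinned to the unitary
  axis (Hecke field + unitarity of `π`: the why-might-fail recorded on the item) — Shahidi 1997 non-vanishing of
  `L^S(1, ∧²π ⊗ η⁻²)` and of Hecke `L`-functions on `Re s = 1`. Needs neither `¬` essentially-self-dual nor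
  `¬` self-twisted (and the stub does not assume them).
* `stub_twoPlusTwoInducesSquare` — **the (2,2)-case induces the exterior square over any number field**
  (Shavali Prop. 4.2 transplanted; size XL, the hardest stub). Same `π` (now also NOT essentially self-dual,
  NOT quadratically self-twisted) and `ρ`; suppose `ρ` has no stable line but splits as `W₁ ⊕ W₂` with
  `Γ_K`-stable PLANES `W₁, W₂` (complementary subrepresentations of dimension 2). Then `∃ (L, P)` as in the
  crux. Proof line: `∧²ρ = det W₁ ⊕ det W₂ ⊕ (W₁ ⊗ W₂)`, BH on `∧²ρ` makes `det W₁ ↔ χ`, `det W₂ ↔ η`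
  algebraic Hecke; `Π := ∧²π` (Kim 2003) is CUSPIDAL by Asgari–Raghuram (π neither essentially self-dual nor
  self-twisted); Shavali's `∧³∘∧²` virtual identity forces `χ⁶ = η⁶`, `χ³ ≠ η³` and a pole at `s = 1` of the
  twisted exterior-cube `L^S(s, Π, ∧³ ⊗ χ⁻³)` over the quadratic field `L` cut out by `χ³η⁻³`, whence
  (Ginzburg–Rallis 2000 + Yamana 2015) `Π = AI_(L/K)(P)` with `P` cuspidal on `GL₃(𝔸_L)`; read off Satake data
  at split and inert places. The GR/Yamana fine print (meromorphy of the PARTIAL `∧³` L-function at `s = 1`,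
  normalisation `ω_Π²χ⁻¹² = 1`, arbitrary number field) and the weight pinning are this stub's risk.
* `ReducibleInducesSquare_of` — the composition, kernel-checked, concluding the route decl BY NAME. Its own
  content is the linear algebra of the case split (proved here, `twoPlusTwo_of_not_isIrreducible`): a
  reducible (`¬ IsSimpleOrder`) semisimple (`ComplementedLattice`) representation of dimension 4 with no
  stable line has two complementary stable planes (a proper non-trivial subrepresentation has dimension 1, 2
  or 3; a complement of a 3-dimensional one is a line).

Disproof used: none on file (`ledger crux ls stmt-Langlands-18054`: no `Disproof.lean`, no `Negative/` lemmas,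
no ideas, 2026-08-17). Negatives index (`ledger negatives --problem Langlands`): no entry is a stub here. Evidence
read: grounder notes (BH Thm 1.1 proved in tree; AR Thm 1 and Ramakrishnan 1994 vendored; GR2000/Yamana ∧³ and
Shahidi1997 wanted as definitions), refuter REVIEW (rreview-0816T23-1: cite Yamana2015ExteriorCube = Math. Z. 279,
not Yamana2014; weight pinning over CM via Hecke field + unitarity, then strict JS on π (3+1) and on the cuspidal
∧²π (2+2)) — the two stubs are exactly the (3+1) and (2+2) halves of that briefing.

Shape (for `ledger skeleton check`): stubs `theorem stub_<name> : <signature> := by sorry` stated over tree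
declarations only (fully qualified, as in the route file); `_Goal.stub_<name> : Prop := type_of% @stub_<name>`
names each statement; `ReducibleInducesSquare_of (hA : _Goal.stub_noStableLine)
(hB : _Goal.stub_twoPlusTwoInducesSquare) : ReducibleInducesSquare` is proved without `sorry`.
-/

set_option linter.dupNamespace false
set_option linter.unusedVariables false

noncomputable section

namespace Summit.Langlands.Langlands.Cruxes.ReducibleInducesSquare.Birth

open Summit.Langlands.Langlands.Theses.ExteriorSquareAscent
open Literature.NumberTheory.GaloisRepresentations Literature.NumberTheory.Automorphic
open NumberField IsDedekindDomain Filter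
open scoped Classical

/-! ## 0. Vocabulary (readability only; the stubs below are spelled out over tree declarations) -/

/-- `π` (cuspidal on `GL₄(𝔸_K)`) **has a Hecke field**: the coefficients `q_v^{i(4-i)/2} e_i(α_v)` of the
C-normalised Satake polynomials lie in one number field `E ⊂ ℂ` for almost all `v` — the route's hypothesis
verbatim (Clozel rationality). [folklore] -/
def HasHeckeField {K : Type} [Field K] [NumberField K] {hcpt : isCompact_glFiniteIntegralLevel 4 K}
    (π : CuspidalAutomorphicRepData 4 K hcpt) : Prop :=
  ∃ E : Subfield ℂ, FiniteDimensional ℚ E ∧ ∀ᶠ v in cofinite, ∀ α : Multiset ℂ, π.1.HasSatakeParamAt v α →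
    ∀ i ≤ 4, ((((Real.sqrt (v.residueCard : ℝ)) : ℝ) : ℂ) ^ (i * (4 - i))) * α.esymm i ∈ E

/-- `π` is **essentially self-dual at Satake level**: some `GL(1)` cuspidal datum `η` with
`t_(π,v)⁻¹ = η_v · t_(π,v)` for almost all `v` — the route's hypothesis verbatim. [folklore] -/
def IsEssSelfDual {K : Type} [Field K] [NumberField K] (h1 : isCompact_glFiniteIntegralLevel 1 K)
    {hcpt : isCompact_glFiniteIntegralLevel 4 K} (π : CuspidalAutomorphicRepData 4 K hcpt) : Prop :=
  ∃ η : CuspidalAutomorphicRepData 1 K h1, ∀ᶠ v in cofinite, ∀ α : Multiset ℂ, π.1.HasSatakeParamAt v α →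
    ∃ e : ℂ, η.1.HasSatakeParamAt v {e} ∧ α.map (fun a => a⁻¹) = α.map (fun a => e * a)

/-- `π` is **quadratically self-twisted at Satake level**: for some quadratic `L'/K`, multiplying the Satake
multiset by the quadratic sign of `L'/K` at `v` (`+1` iff some prime of `L'` over `v` has inertia degree 1)
fixes it, for almost all `v` — the route's hypothesis verbatim. [folklore] -/
def IsQuadSelfTwisted {K : Type} [Field K] [NumberField K] {hcpt : isCompact_glFiniteIntegralLevel 4 K}
    (π : CuspidalAutomorphicRepData 4 K hcpt) : Prop :=
  ∃ (L' : Type) (_ : Field L') (_ : NumberField L') (_ : Algebra K L'), Module.finrank K L' = 2 ∧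
    ∀ᶠ v : HeightOneSpectrum (𝓞 K) in cofinite, ∀ α : Multiset ℂ, π.1.HasSatakeParamAt v α →
      α.map (fun a => (if ∃ w : HeightOneSpectrum (𝓞 L'), w.asIdeal.under (𝓞 K) = v.asIdeal ∧
        w.asIdeal.inertiaDeg (𝓞 K) = 1 then (1 : ℂ) else -1) * a) = α

/-- `ρ : Γ_K → GL₄(ℚ̄_ℓ)` is **Satake–Frobenius compatible with `(π, ι)` almost everywhere**
(C-normalisation `arithFrobPolyOfSatake ι q_v 4`, lang.S27 convention) — the route's hypothesis verbatim.
[folklore] -/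
def IsCompatibleAE {K : Type} [Field K] [NumberField K] {hcpt : isCompact_glFiniteIntegralLevel 4 K}
    (π : CuspidalAutomorphicRepData 4 K hcpt) {ℓ : ℕ} [Fact ℓ.Prime] (ι : PadicAlgCl ℓ ≃+* ℂ)
    (ρ : FramedGaloisRep K (PadicAlgCl ℓ) 4) : Prop :=
  ∀ᶠ v : HeightOneSpectrum (𝓞 K) in cofinite, ∃ α : Multiset ℂ, π.1.HasSatakeParamAt v α ∧
    ρ.IsUnramifiedAt v ∧ ρ.HasFrobCharpolyAt v (arithFrobPolyOfSatake ι v.residueCard 4 α)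

/-- **The exterior square of `π` is induced from `(L, P)` at Satake level**: at almost every `v`, at a split
`v` the multiset `{t_i t_j}_{i<j}` is `t_(P,w₁) ⊔ t_(P,w₂)`, at a non-split `v` it is `γ ⊔ (-γ)` with
`γ² = t_(P,w)` — the crux's conclusion verbatim. [folklore] -/
def SquareInducedFrom {K : Type} [Field K] [NumberField K] {hcpt : isCompact_glFiniteIntegralLevel 4 K}
    (π : CuspidalAutomorphicRepData 4 K hcpt) (L : Type) [Field L] [NumberField L] [Algebra K L]
    {hL3 : isCompact_glFiniteIntegralLevel 3 L} (P : CuspidalAutomorphicRepData 3 L hL3) : Prop :=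
  ∀ᶠ v : HeightOneSpectrum (𝓞 K) in cofinite, ∀ α : Multiset ℂ, π.1.HasSatakeParamAt v α →
    ((∃ w : HeightOneSpectrum (𝓞 L), w.asIdeal.under (𝓞 K) = v.asIdeal ∧ w.asIdeal.inertiaDeg (𝓞 K) = 1) →
      ∃ w₁ w₂ : HeightOneSpectrum (𝓞 L), w₁ ≠ w₂ ∧ w₁.asIdeal.under (𝓞 K) = v.asIdeal ∧
        w₂.asIdeal.under (𝓞 K) = v.asIdeal ∧ ∃ β₁ β₂ : Multiset ℂ, P.1.HasSatakeParamAt w₁ β₁ ∧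
          P.1.HasSatakeParamAt w₂ β₂ ∧ (α.powersetCard 2).map Multiset.prod = β₁ + β₂) ∧
    ((¬ ∃ w : HeightOneSpectrum (𝓞 L), w.asIdeal.under (𝓞 K) = v.asIdeal ∧ w.asIdeal.inertiaDeg (𝓞 K) = 1) →
      ∃ w : HeightOneSpectrum (𝓞 L), w.asIdeal.under (𝓞 K) = v.asIdeal ∧ ∃ β γ : Multiset ℂ,
        P.1.HasSatakeParamAt w β ∧ γ.map (fun c => c ^ 2) = β ∧
          (α.powersetCard 2).map Multiset.prod = γ + γ.map (fun c => -c))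

/-- `ρ` **has no `Γ_K`-stable line**: no subrepresentation of the underlying representation on
`Fin 4 → ℚ̄_ℓ` has dimension 1. [folklore] -/
def NoStableLine {K : Type} [Field K] {ℓ : ℕ} [Fact ℓ.Prime] (ρ : FramedGaloisRep K (PadicAlgCl ℓ) 4) :
    Prop :=
  ∀ W : Subrepresentation ρ.toGaloisRep.toRepresentation, Module.finrank (PadicAlgCl ℓ) W.toSubmodule ≠ 1

/-- The crux unfolded over the vocabulary (definitional). [folklore] -/
theorem reducibleInducesSquare_iff :
    ReducibleInducesSquare ↔
      ∀ (K : Type) [Field K] [NumberField K] (h1 : isCompact_glFiniteIntegralLevel 1 K)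
        (hcpt : isCompact_glFiniteIntegralLevel 4 K) (π : CuspidalAutomorphicRepData 4 K hcpt),
        HasHeckeField π → ¬ IsEssSelfDual h1 π → ¬ IsQuadSelfTwisted π →
          ∀ (ℓ : ℕ) [Fact ℓ.Prime] (ι : PadicAlgCl ℓ ≃+* ℂ) (ρ : FramedGaloisRep K (PadicAlgCl ℓ) 4),
            ρ.toGaloisRep.IsSemisimple → IsCompatibleAE π ι ρ → ¬ ρ.toGaloisRep.IsIrreducible →
              ∃ (L : Type) (_ : Field L) (_ : NumberField L) (_ : Algebra K L), Module.finrank K L = 2 ∧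
                ∃ (hL3 : isCompact_glFiniteIntegralLevel 3 L) (P : CuspidalAutomorphicRepData 3 L hL3),
                  SquareInducedFrom π L P :=
  Iff.rfl

/-! ## 1. The two stubs (Shavali Props 4.1 and 4.2 over any number field) -/

/-- **STUB 1 — the (3,1)-case is impossible over ANY number field (Shavali Prop. 4.1 transplanted; L).**
Let `K` be a number field, `π` cuspidal on `GL₄(𝔸_K)` with a Hecke field, `ρ : Γ_K → GL₄(ℚ̄_ℓ)` semisimple
and Satake–Frobenius compatible with `(π, ι)` at almost all places. Then `ρ` has NO stable line: every
`Γ_K`-subrepresentation of `ℚ̄_ℓ⁴` has dimension `≠ 1`. Route to a proof: a stable line carries a character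
`τ` which weakly divides the `E`-rational `ρ` (`FramedGaloisRep.weaklyDivides_of_stableLine`), so Böckle–Hui
Thm 1.1 (`exists_heckeCharacter_of_weaklyDivides_holds`, any `K`) gives an algebraic Hecke character `η ↔ τ`,
and likewise `χ ↔ det σ = ∧³ρ`-summand; the eight-term identity
`∧²ρ·τ⁻² + τ⁻³det σ + 1 = ρ^∨·det σ·τ⁻² + ρ·τ⁻¹` becomes
`L^S(s,∧²π⊗η⁻²) L^S(s,η⁻³χ) ζ_K^S(s) = L^S(s,π^∨⊗χη⁻²) L^S(s,π⊗η⁻¹)` (Kim's `∧²`, JS a.e. ⇒ equality of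
partial Euler products); right side entire, left side: pole of `ζ_K` at `1` against non-vanishing of
`L^S(1, ∧²π⊗η⁻²)` (Shahidi 1997) and of the Hecke `L`-function on `Re s = 1` — after pinning the weights of
`η, χ` to the unitary axis from the Hecke field and unitarity of `π` (the recorded risk). No self-duality
hypothesis is needed or assumed.
[cite: Shavali2026, Prop. 4.1 (totally real K, ρ = ρ_(π,𝔭))] [cite: BockleHui2025, Thm. 1.1 and §3.2.1]
[cite: Shahidi1997, Thm. 1.1] [cite: Kim2003, Thm. A] [cite: JacquetShalikaAJM1981II, Thm. 4.4] -/
theorem stub_noStableLine :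
    ∀ (K : Type) [Field K] [NumberField K]
      (hcpt : Literature.NumberTheory.Automorphic.isCompact_glFiniteIntegralLevel 4 K)
      (π : Literature.NumberTheory.Automorphic.CuspidalAutomorphicRepData 4 K hcpt),
      (∃ E : Subfield ℂ, FiniteDimensional ℚ E ∧ ∀ᶠ v in Filter.cofinite, ∀ α : Multiset ℂ,
        π.1.HasSatakeParamAt v α →
          ∀ i ≤ 4, ((((Real.sqrt (v.residueCard : ℝ)) : ℝ) : ℂ) ^ (i * (4 - i))) * α.esymm i ∈ E) →
      ∀ (ℓ : ℕ) [Fact ℓ.Prime] (ι : PadicAlgCl ℓ ≃+* ℂ)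
        (ρ : Literature.NumberTheory.GaloisRepresentations.FramedGaloisRep K (PadicAlgCl ℓ) 4),
        ρ.toGaloisRep.IsSemisimple →
        (∀ᶠ v : IsDedekindDomain.HeightOneSpectrum (NumberField.RingOfIntegers K) in Filter.cofinite,
          ∃ α : Multiset ℂ, π.1.HasSatakeParamAt v α ∧ ρ.IsUnramifiedAt v ∧
            ρ.HasFrobCharpolyAt v
              (Literature.NumberTheory.Automorphic.arithFrobPolyOfSatake ι v.residueCard 4 α)) →
        ∀ W : Subrepresentation ρ.toGaloisRep.toRepresentation,
          Module.finrank (PadicAlgCl ℓ) W.toSubmodule ≠ 1 := by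
  sorry

/-- **STUB 2 — the (2,2)-case induces the exterior square over ANY number field (Shavali Prop. 4.2
transplanted; XL, the hardest stub).** Let `K` be a number field, `π` cuspidal on `GL₄(𝔸_K)` with a Hecke
field, NOT essentially self-dual and NOT quadratically self-twisted at Satake level; `ρ : Γ_K → GL₄(ℚ̄_ℓ)`
semisimple, a.e.-compatible with `(π, ι)`, with NO stable line and with two complementary `Γ_K`-stable PLANES
`W₁ ⊕ W₂ = ℚ̄_ℓ⁴`. Then there are a quadratic `L/K` and a cuspidal `P` on `GL₃(𝔸_L)` whose automorphic-induction
Satake data are the exterior-square Satake data of `π` almost everywhere. Route to a proof: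
`∧²ρ = det W₁ ⊕ det W₂ ⊕ (W₁ ⊗ W₂)`; Böckle–Hui on the `E`-rational semisimple `∧²ρ` makes `det W₁ ↔ χ`,
`det W₂ ↔ η` algebraic Hecke characters; `Π := ∧²π` exists (Kim) and is CUSPIDAL (Asgari–Raghuram: `π` is
neither essentially self-dual nor self-twisted); Shavali's `∧³∘∧²` virtual identity and JS/Shahidi pole calculus
force `χ⁶ = η⁶`, `χ³ ≠ η³` and a pole at `s = 1` of `L^S(s, Π, ∧³ ⊗ χ⁻³)` twisted through the quadratic
character `χ³η⁻³` of `L := ` its splitting field, whence `Π ≅ AI_(L/K)(P)`, `P` cuspidal on `GL₃(𝔸_L)`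
(Ginzburg–Rallis + Yamana); the Satake identities at split / inert `v` are the automorphic-induction
dictionary. Risks: GR/Yamana fine print (partial `∧³` L-function, normalisation `ω_Π²χ⁻¹² = 1`, arbitrary
`K`) and weight pinning of `χ, η` before non-vanishing at `s = 1`.
[cite: Shavali2026, Prop. 4.2 (totally real K, ρ = ρ_(π,𝔭))] [cite: BockleHui2025, Thm. 1.1]
[cite: GinzburgRallis2000, main theorem] [cite: Yamana2015ExteriorCube, Thm. (poles of ∧³ on GL₆)]
[cite: AsgariRaghuram2007, Thm. 1.1] [cite: Kim2003, Thm. A] [cite: JacquetShalikaAJM1981II, Thm. 4.4] -/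
theorem stub_twoPlusTwoInducesSquare :
    ∀ (K : Type) [Field K] [NumberField K]
      (h1 : Literature.NumberTheory.Automorphic.isCompact_glFiniteIntegralLevel 1 K)
      (hcpt : Literature.NumberTheory.Automorphic.isCompact_glFiniteIntegralLevel 4 K)
      (π : Literature.NumberTheory.Automorphic.CuspidalAutomorphicRepData 4 K hcpt),
      (∃ E : Subfield ℂ, FiniteDimensional ℚ E ∧ ∀ᶠ v in Filter.cofinite, ∀ α : Multiset ℂ,
        π.1.HasSatakeParamAt v α →
          ∀ i ≤ 4, ((((Real.sqrt (v.residueCard : ℝ)) : ℝ) : ℂ) ^ (i * (4 - i))) * α.esymm i ∈ E) →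
      ¬ (∃ η : Literature.NumberTheory.Automorphic.CuspidalAutomorphicRepData 1 K h1, ∀ᶠ v in Filter.cofinite,
          ∀ α : Multiset ℂ, π.1.HasSatakeParamAt v α →
            ∃ e : ℂ, η.1.HasSatakeParamAt v {e} ∧ α.map (fun a => a⁻¹) = α.map (fun a => e * a)) →
      ¬ (∃ (L' : Type) (_ : Field L') (_ : NumberField L') (_ : Algebra K L'), Module.finrank K L' = 2 ∧
          ∀ᶠ v : IsDedekindDomain.HeightOneSpectrum (NumberField.RingOfIntegers K) in Filter.cofinite,
            ∀ α : Multiset ℂ, π.1.HasSatakeParamAt v α →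
              α.map (fun a => (if ∃ w : IsDedekindDomain.HeightOneSpectrum (NumberField.RingOfIntegers L'),
                w.asIdeal.under (NumberField.RingOfIntegers K) = v.asIdeal ∧
                  w.asIdeal.inertiaDeg (NumberField.RingOfIntegers K) = 1 then (1 : ℂ) else -1) * a) = α) →
      ∀ (ℓ : ℕ) [Fact ℓ.Prime] (ι : PadicAlgCl ℓ ≃+* ℂ)
        (ρ : Literature.NumberTheory.GaloisRepresentations.FramedGaloisRep K (PadicAlgCl ℓ) 4),
        ρ.toGaloisRep.IsSemisimple →
        (∀ᶠ v : IsDedekindDomain.HeightOneSpectrum (NumberField.RingOfIntegers K) in Filter.cofinite,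
          ∃ α : Multiset ℂ, π.1.HasSatakeParamAt v α ∧ ρ.IsUnramifiedAt v ∧
            ρ.HasFrobCharpolyAt v
              (Literature.NumberTheory.Automorphic.arithFrobPolyOfSatake ι v.residueCard 4 α)) →
        (∀ W : Subrepresentation ρ.toGaloisRep.toRepresentation,
          Module.finrank (PadicAlgCl ℓ) W.toSubmodule ≠ 1) →
        ∀ (W₁ W₂ : Subrepresentation ρ.toGaloisRep.toRepresentation), IsCompl W₁ W₂ →
          Module.finrank (PadicAlgCl ℓ) W₁.toSubmodule = 2 →
          Module.finrank (PadicAlgCl ℓ) W₂.toSubmodule = 2 →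
        ∃ (L : Type) (_ : Field L) (_ : NumberField L) (_ : Algebra K L), Module.finrank K L = 2 ∧
          ∃ (hL3 : Literature.NumberTheory.Automorphic.isCompact_glFiniteIntegralLevel 3 L)
            (P : Literature.NumberTheory.Automorphic.CuspidalAutomorphicRepData 3 L hL3),
            ∀ᶠ v : IsDedekindDomain.HeightOneSpectrum (NumberField.RingOfIntegers K) in Filter.cofinite,
              ∀ α : Multiset ℂ, π.1.HasSatakeParamAt v α →
                ((∃ w : IsDedekindDomain.HeightOneSpectrum (NumberField.RingOfIntegers L),
                    w.asIdeal.under (NumberField.RingOfIntegers K) = v.asIdeal ∧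
                      w.asIdeal.inertiaDeg (NumberField.RingOfIntegers K) = 1) →
                  ∃ w₁ w₂ : IsDedekindDomain.HeightOneSpectrum (NumberField.RingOfIntegers L), w₁ ≠ w₂ ∧
                    w₁.asIdeal.under (NumberField.RingOfIntegers K) = v.asIdeal ∧
                    w₂.asIdeal.under (NumberField.RingOfIntegers K) = v.asIdeal ∧
                    ∃ β₁ β₂ : Multiset ℂ, P.1.HasSatakeParamAt w₁ β₁ ∧ P.1.HasSatakeParamAt w₂ β₂ ∧
                      (α.powersetCard 2).map Multiset.prod = β₁ + β₂) ∧
                ((¬ ∃ w : IsDedekindDomain.HeightOneSpectrum (NumberField.RingOfIntegers L),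
                    w.asIdeal.under (NumberField.RingOfIntegers K) = v.asIdeal ∧
                      w.asIdeal.inertiaDeg (NumberField.RingOfIntegers K) = 1) →
                  ∃ w : IsDedekindDomain.HeightOneSpectrum (NumberField.RingOfIntegers L),
                    w.asIdeal.under (NumberField.RingOfIntegers K) = v.asIdeal ∧ ∃ β γ : Multiset ℂ,
                      P.1.HasSatakeParamAt w β ∧ γ.map (fun c => c ^ 2) = β ∧
                        (α.powersetCard 2).map Multiset.prod = γ + γ.map (fun c => -c)) := by
  sorry

/-! ## 2. The stub statements as named `Prop`s (literally their types) -/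

namespace _Goal

/-- The statement of `stub_noStableLine`, as a named `Prop` (literally its type). [folklore] -/
def stub_noStableLine : Prop :=
  type_of% @Summit.Langlands.Langlands.Cruxes.ReducibleInducesSquare.Birth.stub_noStableLine

/-- The statement of `stub_twoPlusTwoInducesSquare`, as a named `Prop` (literally its type). [folklore] -/
def stub_twoPlusTwoInducesSquare : Prop :=
  type_of% @Summit.Langlands.Langlands.Cruxes.ReducibleInducesSquare.Birth.stub_twoPlusTwoInducesSquare

end _Goal

/-- The two named statements over this file's vocabulary (definitional). [folklore] -/
theorem goals_iff :
    (_Goal.stub_noStableLine ↔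
      ∀ (K : Type) [Field K] [NumberField K] (hcpt : isCompact_glFiniteIntegralLevel 4 K)
        (π : CuspidalAutomorphicRepData 4 K hcpt), HasHeckeField π →
          ∀ (ℓ : ℕ) [Fact ℓ.Prime] (ι : PadicAlgCl ℓ ≃+* ℂ) (ρ : FramedGaloisRep K (PadicAlgCl ℓ) 4),
            ρ.toGaloisRep.IsSemisimple → IsCompatibleAE π ι ρ → NoStableLine ρ) ∧
    (_Goal.stub_twoPlusTwoInducesSquare ↔
      ∀ (K : Type) [Field K] [NumberField K] (h1 : isCompact_glFiniteIntegralLevel 1 K)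
        (hcpt : isCompact_glFiniteIntegralLevel 4 K) (π : CuspidalAutomorphicRepData 4 K hcpt),
        HasHeckeField π → ¬ IsEssSelfDual h1 π → ¬ IsQuadSelfTwisted π →
          ∀ (ℓ : ℕ) [Fact ℓ.Prime] (ι : PadicAlgCl ℓ ≃+* ℂ) (ρ : FramedGaloisRep K (PadicAlgCl ℓ) 4),
            ρ.toGaloisRep.IsSemisimple → IsCompatibleAE π ι ρ → NoStableLine ρ →
              ∀ (W₁ W₂ : Subrepresentation ρ.toGaloisRep.toRepresentation), IsCompl W₁ W₂ →
                Module.finrank (PadicAlgCl ℓ) W₁.toSubmodule = 2 →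
                Module.finrank (PadicAlgCl ℓ) W₂.toSubmodule = 2 →
                  ∃ (L : Type) (_ : Field L) (_ : NumberField L) (_ : Algebra K L), Module.finrank K L = 2 ∧
                    ∃ (hL3 : isCompact_glFiniteIntegralLevel 3 L) (P : CuspidalAutomorphicRepData 3 L hL3),
                      SquareInducedFrom π L P) :=
  ⟨Iff.rfl, Iff.rfl⟩

/-! ## 3. The linear algebra of the case split (proved; the composition's own content) -/

/-- **A reducible semisimple representation of dimension 4 with no stable line is `2 + 2`.** Over a field
`k`, let `ρ` be a representation on `V`, `finrank V = 4`, semisimple (`ComplementedLattice` of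
subrepresentations) and not irreducible (`¬ IsSimpleOrder`); if no subrepresentation has dimension 1, then
there are complementary subrepresentations `W₁, W₂` of dimension 2. Proof: `⊥ ≠ ⊤` since `V ≠ 0`, so
`¬ IsSimpleOrder` yields a proper non-trivial `W`; take a complement `W'`; the dimensions are positive, `< 4`,
`≠ 1`, and add up to 4 (`finrank (W ⊔ W') + finrank (W ⊓ W') = finrank W + finrank W'`). [folklore] -/
theorem twoPlusTwo_of_not_isIrreducible {k G V : Type*} [Field k] [Monoid G] [AddCommGroup V]
    [Module k V] [FiniteDimensional k V] (ρ : Representation k G V) (h4 : Module.finrank k V = 4)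
    (hss : ρ.IsSemisimpleRepresentation) (hirr : ¬ ρ.IsIrreducible)
    (hno1 : ∀ W : Subrepresentation ρ, Module.finrank k W.toSubmodule ≠ 1) :
    ∃ W₁ W₂ : Subrepresentation ρ, IsCompl W₁ W₂ ∧ Module.finrank k W₁.toSubmodule = 2 ∧
      Module.finrank k W₂.toSubmodule = 2 := by
  classical
  -- `⊥ ≠ ⊤` among subrepresentations, since `V ≠ 0`
  have hbot : (⊥ : Subrepresentation ρ).toSubmodule = ⊥ := rfl
  have htop : (⊤ : Subrepresentation ρ).toSubmodule = ⊤ := rfl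
  have hV : Nontrivial V := Module.nontrivial_of_finrank_pos (R := k) (by omega)
  have hnt : (⊥ : Subrepresentation ρ) ≠ ⊤ := by
    intro h
    have h' := congrArg Subrepresentation.toSubmodule h
    rw [hbot, htop] at h'
    exact bot_ne_top h'
  -- a proper non-trivial subrepresentation `W` …
  obtain ⟨W, hWb, hWt⟩ : ∃ W : Subrepresentation ρ, W ≠ ⊥ ∧ W ≠ ⊤ := by
    by_contra h
    push Not at h
    apply hirr
    haveI : Nontrivial (Subrepresentation ρ) := ⟨⟨⊥, ⊤, hnt⟩⟩
    exact ⟨fun W => (Classical.em (W = ⊥)).imp_right (h W)⟩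
  -- … and a complement `W'` (semisimplicity)
  haveI := hss
  obtain ⟨W', hWW'⟩ := exists_isCompl W
  have hWb' : W.toSubmodule ≠ ⊥ := fun h =>
    hWb (Subrepresentation.toSubmodule_injective (h.trans hbot.symm))
  have hWt' : W.toSubmodule ≠ ⊤ := fun h =>
    hWt (Subrepresentation.toSubmodule_injective (h.trans htop.symm))
  have hinf : W.toSubmodule ⊓ W'.toSubmodule = ⊥ := by
    have := hWW'.disjoint
    rw [disjoint_iff] at this
    exact (congrArg Subrepresentation.toSubmodule this).trans hbot
  have hsup : W.toSubmodule ⊔ W'.toSubmodule = ⊤ := by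
    have := hWW'.codisjoint
    rw [codisjoint_iff] at this
    exact (congrArg Subrepresentation.toSubmodule this).trans htop
  -- dimension count: `dim W + dim W' = 4`, `0 < dim W < 4`, neither is `1`
  have hsum : Module.finrank k W.toSubmodule + Module.finrank k W'.toSubmodule = 4 := by
    have := Submodule.finrank_sup_add_finrank_inf_eq W.toSubmodule W'.toSubmodule
    rw [hinf, hsup, finrank_top, finrank_bot, h4] at this
    omega
  have hpos : 0 < Module.finrank k W.toSubmodule := by
    rw [pos_iff_ne_zero, Ne, Submodule.finrank_eq_zero]
    exact hWb'
  have hlt : Module.finrank k W.toSubmodule < 4 := by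
    rw [← h4]
    exact Submodule.finrank_lt hWt'
  have h1 := hno1 W
  have h1' := hno1 W'
  exact ⟨W, W', hWW', by omega, by omega⟩

/-- The framed Galois case used by the composition: a reducible semisimple `ρ : Γ_K → GL₄(ℚ̄_ℓ)` with no
stable line has two complementary stable planes. [folklore] -/
theorem twoPlusTwo_of_reducible {K : Type} [Field K] {ℓ : ℕ} [Fact ℓ.Prime]
    (ρ : FramedGaloisRep K (PadicAlgCl ℓ) 4) (hss : ρ.toGaloisRep.IsSemisimple)
    (hirr : ¬ ρ.toGaloisRep.IsIrreducible)
    (hno1 : ∀ W : Subrepresentation ρ.toGaloisRep.toRepresentation,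
      Module.finrank (PadicAlgCl ℓ) W.toSubmodule ≠ 1) :
    ∃ W₁ W₂ : Subrepresentation ρ.toGaloisRep.toRepresentation, IsCompl W₁ W₂ ∧
      Module.finrank (PadicAlgCl ℓ) W₁.toSubmodule = 2 ∧ Module.finrank (PadicAlgCl ℓ) W₂.toSubmodule = 2 :=
  twoPlusTwo_of_not_isIrreducible ρ.toGaloisRep.toRepresentation (Module.finrank_fin_fun (PadicAlgCl ℓ))
    hss hirr hno1

/-! ## 4. The composition (kernel-checked, no `sorry`): (3,1) excluded → case split → (2,2) induces -/

/-- **`ReducibleInducesSquare` from the two stubs.** Fix `K, π, ℓ, ι, ρ` as in the crux with `ρ` reducible.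
`stub_noStableLine` (which uses only the Hecke field, semisimplicity and compatibility) excludes every stable
line; the linear algebra `twoPlusTwo_of_reducible` then splits `ρ` as two complementary stable planes; and
`stub_twoPlusTwoInducesSquare` produces the quadratic `L/K` and the cuspidal `P` on `GL₃(𝔸_L)`. The hypotheses
are, by name, the statements of the two stubs; the conclusion is the route decl
`Summit.Langlands.Langlands.Theses.ExteriorSquareAscent.ReducibleInducesSquare`. [folklore] -/
theorem ReducibleInducesSquare_of (hA : _Goal.stub_noStableLine) (hB : _Goal.stub_twoPlusTwoInducesSquare) :
    Summit.Langlands.Langlands.Theses.ExteriorSquareAscent.ReducibleInducesSquare := by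
  -- the stub statements, as the Π-types they literally are
  have hLine : type_of% @stub_noStableLine := hA
  have hPlane : type_of% @stub_twoPlusTwoInducesSquare := hB
  intro K _ _ h1 hcpt π hE hNE hST ℓ _ ι ρ hss hcomp hirr
  -- (3,1) EXCLUDED: no stable line
  have hno1 : ∀ W : Subrepresentation ρ.toGaloisRep.toRepresentation,
      Module.finrank (PadicAlgCl ℓ) W.toSubmodule ≠ 1 :=
    hLine K hcpt π hE ℓ ι ρ hss hcomp
  -- CASE SPLIT: a reducible semisimple `ρ` with no stable line is `2 + 2`
  obtain ⟨W₁, W₂, hc, hW₁, hW₂⟩ := twoPlusTwo_of_reducible ρ hss hirr hno1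
  -- (2,2) INDUCES: the quadratic field and the cuspidal `P` on `GL₃`
  exact hPlane K h1 hcpt π hE hNE hST ℓ ι ρ hss hcomp hno1 W₁ W₂ hc hW₁ hW₂

/-- By-name sanity check (an `example`, not a declaration of the file): the two stubs feed the composition as
they stand. -/
example : Summit.Langlands.Langlands.Theses.ExteriorSquareAscent.ReducibleInducesSquare :=
  ReducibleInducesSquare_of stub_noStableLine stub_twoPlusTwoInducesSquare

end Summit.Langlands.Langlands.Cruxes.ReducibleInducesSquare.Birth

end
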